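import Summits.CriticalPhenomena.PercolationContinuityZ3.Theorems.PercNearOneGluingNoHeavyPcintThirdMemBook
import HarnessLib

/-!
# PCINT lane, reduction B3t on the memory-`τ` DANGEROUS-SET automaton — booking at a future vertex and on the chords

Cell `prim-pcint` (PAPER-2 track (iii): certified intervals for `p_c(ℤ^d)`), seat `prim-pcint-2` (gen 4); support file
(`--supports stmt-CriticalPhenomena-4575`).  Does NOT build on p205010.  Memo: `run/shared/lean/prim/pcint/REDUCTIONS.md` §B3t.

Continuation of `…ThirdMemBook`: the charges at a future path vertex `v_h` (`futureEv`, index `kp h` of the incidence `h-1`) total at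
most `kp h + 1` units with at most `kp h - 1` `t`-units (`sum_units_future_le`, `sum_tunits_future_le`, by `units_prefix_le`), so
`∏ chargeF ≥ s² t^{kp h - 1}` (`prod_chargeF_future_ge`); the chords with upper endpoint `h` number `kp h`
(`card_chordPairs_fiber`) and the per-endpoint booking inequality `chord_booking_ineq`.
-/

noncomputable section

namespace Summit.CriticalPhenomena.PercolationContinuityZ3.Theorems.Pcint

open Finset Literature.Probability.Percolation Literature.Probability.LatticeModels ChainBond

variable {d : ℕ} (a₀ : Fin d × Bool) {τ kc n : ℕ} {γ : Fin n → Fin d × Bool}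

/-! ### Booking at a future vertex -/

section Future

open Classical

/-- The index of the incidence `h - 1` of the path vertex `v_h` among the incidences of the site `v_h` (`1 ≤ h ≤ n`):
the number of chord partners of `v_h` below `h - 1`. [folklore] -/
def kp (γ : Fin n → Fin d × Bool) (h : ℕ) : ℕ :=
  ((incTimes γ (wordPos γ h)).filter (· < h - 1)).card

/-- `h - 1` is an incidence of `v_h` of index `kp h`. [folklore] -/
theorem incAt_kp {h : ℕ} (h1 : 1 ≤ h) (hn : h ≤ n) :
    kp γ h < (incTimes γ (wordPos γ h)).card ∧ incAt γ (wordPos γ h) (kp γ h) = h - 1 := by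
  set x := wordPos γ h with hx
  have hmem : h - 1 ∈ incTimes γ x := by
    refine mem_incTimes.2 ⟨by omega, ?_⟩
    have := zdGraph_adj_wordPos_succ γ (show h - 1 < n by omega)
    rw [show h - 1 + 1 = h by omega] at this
    exact this
  obtain ⟨k, hk, hkh⟩ := exists_incAt_eq hmem
  -- the incidences below `h - 1` are exactly those of index `< k`
  have hset : (incTimes γ x).filter (· < h - 1) = (range k).image (incAt γ x) := by
    ext i
    rw [mem_filter, mem_image]
    constructor
    · rintro ⟨hi, hih⟩
      obtain ⟨j, hj, hji⟩ := exists_incAt_eq hi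
      refine ⟨j, mem_range.2 ?_, hji⟩
      by_contra hjk
      rcases Nat.lt_or_ge k j with hlt | hge
      · have := incAt_strictMono hlt hj; omega
      · have : j = k := by omega
        subst this; omega
    · rintro ⟨j, hj, rfl⟩
      have hjk := mem_range.1 hj
      exact ⟨incAt_mem (hjk.trans hk), by rw [← hkh]; exact incAt_strictMono hjk hk⟩
  have hkp : kp γ h = k := by
    rw [kp, ← hx, hset, card_image_of_injOn fun j hj j' hj' e =>
      incAt_inj ((mem_range.1 (mem_coe.1 hj)).trans hk) ((mem_range.1 (mem_coe.1 hj')).trans hk) e, card_range]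
  rw [hkp]; exact ⟨hk, hkh⟩

/-- An incidence time `< h` of `v_h` has index `≤ kp h`. [folklore] -/
theorem index_le_kp {h : ℕ} (h1 : 1 ≤ h) (hn : h ≤ n) {k : ℕ} (hk : k < (incTimes γ (wordPos γ h)).card)
    (hlt : incAt γ (wordPos γ h) k < h) : k ≤ kp γ h := by
  obtain ⟨hkp, hkph⟩ := incAt_kp (γ := γ) h1 hn
  by_contra hgt
  have := incAt_strictMono (show kp γ h < k by omega) hk
  have hne : incAt γ (wordPos γ h) k ≠ h := by
    intro he
    have := (mem_incTimes.1 (incAt_mem hk)).2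
    rw [he] at this
    exact this.ne rfl
  omega

variable {s tv : ℝ}

/-- The future events at `v_h`: on-path events `(t, h)` with `t + 1 < h`. [folklore] -/
def futureEv (τ : ℕ) (γ : Fin n → Fin d × Bool) (h : ℕ) : Finset (ℕ × ℕ) :=
  (onEventsR τ γ).filter fun th => th.2 = h ∧ th.1 + 1 < h

/-- The index of the incidence `t + 1` of `v_h` for a future event `(t, h)`. [folklore] -/
theorem futureEv_index {h : ℕ} {th : ℕ × ℕ} (hth : th ∈ futureEv τ γ h) :
    ∃ k, k < (incTimes γ (wordPos γ h)).card ∧ incAt γ (wordPos γ h) k = th.1 + 1 ∧ k ≤ kp γ h ∧ 1 ≤ k := by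
  obtain ⟨hE, hh, hlt⟩ := mem_filter.1 hth
  obtain ⟨htn, hhn, -, -, -, hadj, i, hit, hir, hadji⟩ := mem_onEventsR.1 hE
  rw [hh] at hadj hadji hhn
  have hT : th.1 + 1 ∈ incTimes γ (wordPos γ h) := mem_incTimes.2 ⟨by omega, hadj.symm⟩
  obtain ⟨k, hk, hkT⟩ := exists_incAt_eq hT
  have h1 : 1 ≤ h := by omega
  refine ⟨k, hk, hkT, index_le_kp h1 hhn hk (by rw [hkT]; exact hlt), ?_⟩
  -- the remembered incidence `i < t` has a smaller index
  have hI : i ∈ incTimes γ (wordPos γ h) := mem_incTimes.2 ⟨by omega, hadji⟩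
  obtain ⟨j, hj, hji⟩ := exists_incAt_eq hI
  by_contra hk0
  have hk0' : k = 0 := by omega
  subst hk0'
  rcases Nat.eq_zero_or_pos j with hj0 | hj0
  · subst hj0; omega
  · have := incAt_strictMono hj0 hj; omega

/-- **The future charges at `v_h` total at most `kp h + 1` units.** [folklore] -/
theorem sum_units_future_le (hτ : kc + 4 ≤ τ) (hkc : 2 ≤ kc) {h : ℕ} (h1 : 1 ≤ h) (hn : h ≤ n) :
    ∑ th ∈ futureEv τ γ h, (ecs a₀ τ kc γ th.1 (wordPos γ h) + ect a₀ τ kc γ th.1 (wordPos γ h)) ≤ kp γ h + 1 := by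
  set x := wordPos γ h with hx
  obtain ⟨hkpr, hkph⟩ := incAt_kp (γ := γ) h1 hn
  -- each event's units are at most the full-information units of its incidence (plus two for a corner first pair)
  have hev : ∀ th ∈ futureEv τ γ h, ecs a₀ τ kc γ th.1 x + ect a₀ τ kc γ th.1 x ≤
      uF kc γ x (th.1 + 1) + (if incAt γ x 1 = th.1 + 1 ∧ firstCorner γ x then 2 else 0) := by
    intro th hth
    have htn := (mem_onEventsR.1 (mem_filter.1 hth).1).1
    unfold ecs ect
    rw [dif_pos htn, dif_pos htn]
    by_cases hD : x - wordPos γ th.1 ∈ cdetSet kc (danger τ (pre a₀ γ th.1)) (γ ⟨th.1, htn⟩)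
    · have hnc : ¬ (bcorner (danger τ (pre a₀ γ th.1)) (γ ⟨th.1, htn⟩) = true ∧ cornerSite γ (th.1 - 1) = x) := by
        rintro ⟨hc, hCx⟩
        obtain ⟨-, -, -, -, -, -, -, hfree⟩ := bcorner_spec a₀ htn hc
        have hD' := hD
        rw [cdetSet, mem_filter] at hD'
        obtain ⟨-, -, -, ⟨q, hq, hq2⟩, -⟩ := hD'
        rw [← hCx] at hq
        exact hfree q (mem_bcinc.1 hq).1 hq2 (mem_bcinc.1 hq).2
      rw [if_pos hD, if_pos hD, if_neg hnc, add_zero]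
      have hU := one_add_bcbonus_le_uF a₀ hτ htn hD
      rw [sub_add_cancel] at hU
      have hUA : uA τ kc (danger τ (pre a₀ γ th.1)) (x - wordPos γ th.1) ≤ uF kc γ x (th.1 + 1) := by unfold uA; exact hU
      have h2 := uAt_le_uA τ kc (danger τ (pre a₀ γ th.1)) (γ ⟨th.1, htn⟩) (x - wordPos γ th.1)
      omega
    · rw [if_neg hD, if_neg hD, zero_add, add_zero]
      by_cases hcx : bcorner (danger τ (pre a₀ γ th.1)) (γ ⟨th.1, htn⟩) = true ∧ cornerSite γ (th.1 - 1) = x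
      · rw [if_pos hcx]
        have := two_le_uF_cornerSite' a₀ hτ hkc htn hcx.1
        rw [hcx.2] at this
        exact this
      · rw [if_neg hcx]; exact Nat.zero_le _
  refine (sum_le_sum hev).trans ?_
  rw [sum_add_distrib]
  -- the incidence indices of the events are distinct and `≤ kp h`
  set K := (futureEv τ γ h).image fun th => th.1 + 1 with hK
  have hKinj : Set.InjOn (fun th : ℕ × ℕ => th.1 + 1) ↑(futureEv τ γ h) := by
    intro th hth th' hth' e
    have h2 := (mem_filter.1 (mem_coe.1 hth)).2.1
    have h2' := (mem_filter.1 (mem_coe.1 hth')).2.1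
    exact Prod.ext (by simpa using e) (h2.trans h2'.symm)
  -- (1) base and bonus units
  have hunits : ∑ th ∈ futureEv τ γ h, uF kc γ x (th.1 + 1) ≤
      ((paySet kc γ x).filter (· < kp γ h + 1)).card + ((bonusSet kc γ x).filter (· < kp γ h + 1)).card := by
    rw [← sum_image (f := fun T => uF kc γ x T) (g := fun th : ℕ × ℕ => th.1 + 1) hKinj]
    -- rewrite each term through its index
    have hterm : ∀ T ∈ K, ∃ k, k ≤ kp γ h ∧ k < (incTimes γ x).card ∧ incAt γ x k = T := by
      intro T hT
      obtain ⟨th, hth, rfl⟩ := mem_image.1 hT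
      obtain ⟨k, hk, hkT, hkle, -⟩ := futureEv_index (γ := γ) hth
      exact ⟨k, hkle, hk, hkT⟩
    -- inject `K` into the indices `≤ kp h`
    have hKsub : K ⊆ (range (kp γ h + 1)).image (incAt γ x) := by
      intro T hT
      obtain ⟨k, hkle, hk, hkT⟩ := hterm T hT
      exact mem_image.2 ⟨k, mem_range.2 (by omega), hkT⟩
    have hinjI : Set.InjOn (incAt γ x) ↑(range (kp γ h + 1)) := fun j hj j' hj' e =>
      incAt_inj (lt_of_lt_of_le (mem_range.1 (mem_coe.1 hj)) hkpr) (lt_of_lt_of_le (mem_range.1 (mem_coe.1 hj')) hkpr) e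
    calc ∑ T ∈ K, uF kc γ x T ≤ ∑ T ∈ (range (kp γ h + 1)).image (incAt γ x), uF kc γ x T :=
          sum_le_sum_of_subset hKsub
      _ = ∑ k ∈ range (kp γ h + 1), uF kc γ x (incAt γ x k) := sum_image hinjI
      _ = ∑ k ∈ range (kp γ h + 1), ((if k ∈ paySet kc γ x then 1 else 0) + (if k ∈ bonusSet kc γ x then 1 else 0)) :=
          sum_congr rfl fun k hk => uF_incAt γ x (lt_of_lt_of_le (mem_range.1 hk) hkpr)
      _ = ((paySet kc γ x).filter (· < kp γ h + 1)).card + ((bonusSet kc γ x).filter (· < kp γ h + 1)).card := by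
          rw [sum_add_distrib, sum_boole, sum_boole, Nat.cast_id, Nat.cast_id]
          congr 1 <;> · congr 1; ext k; simp [mem_filter, and_comm]
  -- (2) the corner first pair, at most once, and only if `kp h ≥ 1`
  have hcorner : ∑ th ∈ futureEv τ γ h, (if incAt γ x 1 = th.1 + 1 ∧ firstCorner γ x then 2 else 0) ≤
      (if firstCorner γ x ∧ 2 ≤ kp γ h + 1 then 2 else 0) := by
    by_cases hfc : firstCorner γ x
    · have hcard : ((futureEv τ γ h).filter fun th => incAt γ x 1 = th.1 + 1 ∧ firstCorner γ x).card ≤ 1 :=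
        card_le_one.2 fun th hth th' hth' => by
          obtain ⟨h1m, h1e⟩ := mem_filter.1 hth
          obtain ⟨h2m, h2e⟩ := mem_filter.1 hth'
          exact hKinj (mem_coe.2 h1m) (mem_coe.2 h2m) (by simp only; omega)
      rw [← sum_filter_add_sum_filter_not (futureEv τ γ h) (fun th => incAt γ x 1 = th.1 + 1 ∧ firstCorner γ x)]
      rw [sum_congr rfl fun th hth => if_pos (mem_filter.1 hth).2, sum_congr rfl fun th hth => if_neg (mem_filter.1 hth).2,
        sum_const_nat fun _ _ => rfl, sum_const_zero, add_zero]
      by_cases hne : ((futureEv τ γ h).filter fun th => incAt γ x 1 = th.1 + 1 ∧ firstCorner γ x).Nonempty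
      · obtain ⟨th, hth⟩ := hne
        obtain ⟨hthm, h1e, -⟩ := mem_filter.1 hth
        obtain ⟨k, hk, hkT, hkle, hk1⟩ := futureEv_index (γ := γ) hthm
        have : k = 1 := incAt_inj hk (by have := hfc.1; omega) (hkT.trans h1e.symm)
        subst this
        rw [if_pos ⟨hfc, by omega⟩]; omega
      · rw [Finset.not_nonempty_iff_eq_empty] at hne
        rw [hne, card_empty, zero_mul]; exact Nat.zero_le _
    · rw [sum_congr rfl fun th _ => if_neg (fun h => hfc h.2), sum_const_zero, if_neg (fun h => hfc h.1)]
  have := units_prefix_le hkc γ x (kp γ h + 1)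
  omega

/-- **At most `kp h - 1` future `t`-units at `v_h`.** [folklore] -/
theorem sum_tunits_future_le (hτ : kc + 4 ≤ τ) (hkc : 2 ≤ kc) {h : ℕ} (h1 : 1 ≤ h) (hn : h ≤ n) :
    ∑ th ∈ futureEv τ γ h, ect a₀ τ kc γ th.1 (wordPos γ h) ≤ kp γ h - 1 := by
  set x := wordPos γ h with hx
  obtain ⟨hkpr, hkph⟩ := incAt_kp (γ := γ) h1 hn
  -- each `t`-unit is a full-information `t`-unit of an incidence of index in `[2, kp h]`
  have hev : ∀ th ∈ futureEv τ γ h, ect a₀ τ kc γ th.1 x ≤ uFt kc γ x (th.1 + 1) := by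
    intro th hth
    have htn := (mem_onEventsR.1 (mem_filter.1 hth).1).1
    unfold ect
    rw [dif_pos htn]
    split_ifs with hD
    · unfold uAt
      split_ifs with hT
      · have := one_le_uFt_of_mem_ctSet a₀ hτ hkc htn hT
        rw [sub_add_cancel] at this; exact this
      · exact Nat.zero_le _
    · exact Nat.zero_le _
  refine (sum_le_sum hev).trans ?_
  have hKinj : Set.InjOn (fun th : ℕ × ℕ => th.1 + 1) ↑(futureEv τ γ h) := by
    intro th hth th' hth' e
    have h2 := (mem_filter.1 (mem_coe.1 hth)).2.1
    have h2' := (mem_filter.1 (mem_coe.1 hth')).2.1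
    exact Prod.ext (by simpa using e) (h2.trans h2'.symm)
  rw [← sum_image (f := fun T => uFt kc γ x T) (g := fun th : ℕ × ℕ => th.1 + 1) hKinj]
  set K := (futureEv τ γ h).image fun th => th.1 + 1 with hK
  have hKsub : K ⊆ (range (kp γ h + 1)).image (incAt γ x) := by
    intro T hT
    obtain ⟨th, hth, rfl⟩ := mem_image.1 hT
    obtain ⟨k, hk, hkT, hkle, -⟩ := futureEv_index (γ := γ) hth
    exact mem_image.2 ⟨k, mem_range.2 (by omega), hkT⟩
  have hinjI : Set.InjOn (incAt γ x) ↑(range (kp γ h + 1)) := fun j hj j' hj' e =>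
    incAt_inj (lt_of_lt_of_le (mem_range.1 (mem_coe.1 hj)) hkpr) (lt_of_lt_of_le (mem_range.1 (mem_coe.1 hj')) hkpr) e
  have hterm : ∀ k ∈ range (kp γ h + 1), uFt kc γ x (incAt γ x k) ≤ if 2 ≤ k then 1 else 0 := by
    intro k hk
    have hkr : k < (incTimes γ x).card := lt_of_lt_of_le (mem_range.1 hk) hkpr
    split_ifs with h2
    · exact uFt_le_one γ x _
    · rw [uFt_incAt_eq_zero_of_lt_two γ x hkr (by omega)]
  have hcount : ((range (kp γ h + 1)).filter fun k => 2 ≤ k).card ≤ kp γ h - 1 := by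
    have := card_le_card_of_injOn (s := (range (kp γ h + 1)).filter fun k => 2 ≤ k) (t := range (kp γ h - 1))
      (fun k => k - 2) (fun k hk => by
        obtain ⟨hk1, hk2⟩ := mem_filter.1 (mem_coe.1 hk)
        rw [mem_coe, mem_range]; have := mem_range.1 hk1; show k - 2 < kp γ h - 1; omega)
      (fun k hk k' hk' e => by
        have h2 := (mem_filter.1 (mem_coe.1 hk)).2
        have h2' := (mem_filter.1 (mem_coe.1 hk')).2
        simp only at e; omega)
    rwa [card_range] at this
  calc ∑ T ∈ K, uFt kc γ x T ≤ ∑ T ∈ (range (kp γ h + 1)).image (incAt γ x), uFt kc γ x T := sum_le_sum_of_subset hKsub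
    _ = ∑ k ∈ range (kp γ h + 1), uFt kc γ x (incAt γ x k) := sum_image hinjI
    _ ≤ ∑ k ∈ range (kp γ h + 1), (if 2 ≤ k then 1 else 0) := sum_le_sum hterm
    _ = ((range (kp γ h + 1)).filter fun k => 2 ≤ k).card := by rw [sum_boole, Nat.cast_id]
    _ ≤ kp γ h - 1 := hcount

/-- **The future charges at `v_h` multiply to at least `s² t^{kp h - 1}`** (or `1` if `kp h = 0`). [folklore] -/
theorem prod_chargeF_future_ge (hτ : kc + 4 ≤ τ) (hkc : 2 ≤ kc) (hs0 : 0 ≤ s) (hs1 : s ≤ 1) (ht0 : 0 ≤ tv)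
    (hts : tv ≤ s) {h : ℕ} (hn : h ≤ n) :
    (if 1 ≤ kp γ h then s ^ 2 * tv ^ (kp γ h - 1) else 1) ≤
      ∏ th ∈ futureEv τ γ h, chargeF a₀ s tv τ kc γ th.1 (wordPos γ h) := by
  by_cases hE : futureEv τ γ h = ∅
  · rw [hE, prod_empty]
    split_ifs
    · exact mul_le_one₀ (pow_le_one₀ hs0 hs1) (pow_nonneg ht0 _) (pow_le_one₀ ht0 (hts.trans hs1))
    · exact le_rfl
  obtain ⟨th0, hth0⟩ := nonempty_iff_ne_empty.2 hE
  have h1 : 1 ≤ h := by have := (mem_filter.1 hth0).2.2; omega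
  obtain ⟨k0, -, -, hk0le, hk01⟩ := futureEv_index (γ := γ) hth0
  have hkp1 : 1 ≤ kp γ h := by omega
  rw [if_pos hkp1, prod_congr rfl fun th _ => chargeF_eq_pow a₀ th.1 (wordPos γ h), prod_mul_distrib,
    prod_pow_eq_pow_sum, prod_pow_eq_pow_sum]
  have hA := sum_units_future_le a₀ (γ := γ) hτ hkc h1 hn
  have hB := sum_tunits_future_le a₀ (γ := γ) hτ hkc h1 hn
  rw [sum_add_distrib] at hA
  exact spow_tpow_le hs1 ht0 hts hB (by omega)

end Future

/-! ### The chords with a given upper endpoint -/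

/-- **The chords with upper endpoint `h` number `kp h`** (`1 ≤ h ≤ n`). [folklore] -/
theorem card_chordPairs_fiber {h : ℕ} (h1 : 1 ≤ h) (hn : h ≤ n) :
    ((chordPairs γ).filter fun ij => ij.2 = h).card = kp γ h := by
  classical
  obtain ⟨hkpr, hkph⟩ := incAt_kp (γ := γ) h1 hn
  set x := wordPos γ h with hx
  symm
  rw [show kp γ h = (range (kp γ h)).card from (card_range _).symm]
  refine card_nbij (fun k => (incAt γ x k, h)) (fun k hk => ?_) (fun k hk k' hk' e => ?_) (fun ij hij => ?_)
  · have hk' := mem_range.1 (mem_coe.1 hk)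
    have hlt : incAt γ x k < incAt γ x (kp γ h) := incAt_strictMono hk' hkpr
    have hmem := incAt_mem (hk'.trans hkpr)
    obtain ⟨-, hadj⟩ := mem_incTimes.1 hmem
    rw [mem_coe, mem_filter, mem_chordPairs]
    refine ⟨⟨?_, hn, hadj⟩, rfl⟩
    simp only
    have hgap := incTimes_gap hmem (incAt_mem hkpr) hlt
    omega
  · exact incAt_inj ((mem_range.1 (mem_coe.1 hk)).trans hkpr) ((mem_range.1 (mem_coe.1 hk')).trans hkpr) (Prod.mk.inj e).1
  · rw [mem_coe, mem_filter, mem_chordPairs] at hij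
    obtain ⟨⟨hij1, -, hadj⟩, hij2⟩ := hij
    rw [hij2] at hadj hij1
    have hmem : ij.1 ∈ incTimes γ x := mem_incTimes.2 ⟨by omega, hadj⟩
    obtain ⟨k, hk, hke⟩ := exists_incAt_eq hmem
    have hkle := index_le_kp (γ := γ) h1 hn hk (by rw [hke]; omega)
    have hkne : k ≠ kp γ h := by intro he; rw [he, hkph] at hke; omega
    exact ⟨k, mem_coe.2 (mem_range.2 (by omega)), Prod.ext hke hij2.symm⟩

/-- **The booking inequality of one upper endpoint**: with `cv` detected and `ci` undetected chords,
`q₁^{cv+ci} ≤ tchordF cv · (s² t^{cv+ci-1} ‖ 1) · (s t)^{ci}` (`0 ≤ q₁ ≤ s t²`, `t ≤ s²`, `s, t > 0`). [folklore] -/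
theorem chord_booking_ineq {q1 s tv : ℝ} (hq0 : 0 ≤ q1) (hs : 0 < s) (ht : 0 < tv) (hst2 : q1 ≤ s * tv ^ 2)
    (hts2 : tv ≤ s ^ 2) (cv ci : ℕ) :
    q1 ^ (cv + ci) ≤ tchordF q1 s tv cv * (if 1 ≤ cv + ci then s ^ 2 * tv ^ (cv + ci - 1) else 1) * (s * tv) ^ ci := by
  unfold tchordF
  rcases Nat.eq_zero_or_pos cv with hcv | hcv
  · subst hcv
    rw [if_pos rfl, one_mul, zero_add]
    rcases Nat.eq_zero_or_pos ci with hci | hci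
    · subst hci; simp
    · rw [if_pos (show 1 ≤ ci by omega)]
      -- `s² t^{ci-1} (s t)^{ci} = (s t²)^{ci} · (s² / t) ≥ q1^{ci}`
      obtain ⟨m, rfl⟩ : ∃ m, ci = m + 1 := ⟨ci - 1, by omega⟩
      rw [show m + 1 - 1 = m by omega]
      calc q1 ^ (m + 1) ≤ (s * tv ^ 2) ^ (m + 1) := pow_le_pow_left₀ hq0 hst2 _
        _ = tv * tv ^ m * (s * tv) ^ (m + 1) := by ring
        _ ≤ s ^ 2 * tv ^ m * (s * tv) ^ (m + 1) := by gcongr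
  · rw [if_neg (by omega), if_pos (by omega)]
    obtain ⟨m, rfl⟩ : ∃ m, cv = m + 1 := ⟨cv - 1, by omega⟩
    rw [show m + 1 - 1 = m by omega, show m + 1 + ci - 1 = m + ci by omega]
    have hden : 0 < s ^ 2 * tv ^ m := by positivity
    rw [div_mul_eq_mul_div, div_mul_eq_mul_div, le_div_iff₀ hden]
    calc q1 ^ (m + 1 + ci) * (s ^ 2 * tv ^ m) = q1 ^ (m + 1) * q1 ^ ci * (s ^ 2 * tv ^ m) := by rw [pow_add]
      _ ≤ q1 ^ (m + 1) * (s * tv ^ 2) ^ ci * (s ^ 2 * tv ^ m) := by gcongr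
      _ = q1 ^ (m + 1) * (s ^ 2 * tv ^ (m + ci)) * (s * tv) ^ ci := by ring

end Summit.CriticalPhenomena.PercolationContinuityZ3.Theorems.Pcint
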